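import Summits.AtomisticToContinuum.BoseEinsteinCondensation.Theses.BECInsertionVariance
import Summits.AtomisticToContinuum.BoseEinsteinCondensation.Theorems.BECInsertionVarianceGroundStateAccessibleSwapMass
import Summits.AtomisticToContinuum.BoseEinsteinCondensation.Theorems.BECInsertionVarianceGroundStateAccessibleFKGroundState
import Summits.AtomisticToContinuum.BoseEinsteinCondensation.Theorems.BECCutLineWeakDisorderGroundStateRigidityStubCompactness
import Summits.AtomisticToContinuum.BoseEinsteinCondensation.Theorems.BECCutLineWeakDisorderGroundStateRigidityStubFkJensen
import Summits.AtomisticToContinuum.BoseEinsteinCondensation.Theorems.BECCutLineWeakDisorderGroundStateRigidityStubStabilityOfJensen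
import Summits.AtomisticToContinuum.BoseEinsteinCondensation.Theorems.BECCutLineWeakDisorderGroundStateRigidityStubUniqueOfStability
import Literature.MathematicalPhysics.QuantumManyBody.SwapEntropy
import Literature.MathematicalPhysics.QuantumManyBody.BoseGasDirichletWall
import HarnessLib

/-!
# `GroundStateAccessible`: the bounded-potential half, discharged

Helper for item `GroundStateAccessible` (stmt-AtomisticToContinuum-12069) of route `BECInsertionVariance`
(`Summit.AtomisticToContinuum.BoseEinsteinCondensation.Theses.BECInsertionVariance.GroundStateAccessible`:
for admissible `v`, small `ρ` and all large `N = n + 1`, the accessible swap mass of THE nonnegative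
Dirichlet ground state `groundState v N (N/ρ)^{1/3}` is `≥ 1/2`).

With the four stubs `stub_compactness`, `stub_fkJensen`, `stub_stabilityOfJensen`,
`stub_uniqueOfStability` of crux `GroundStateRigidity` (stmt-AtomisticToContinuum-9072, line `Sketch`)
landed, the BOUNDED half of the item is unconditional:

* `hasUniqueGroundState_of_bounded` — for measurable bounded `v`, `N ≥ 1`, `L > 0` the Dirichlet
  ground state is unique up to phase (Perron–Frobenius for the Feynman–Kac semigroup transported to the
  closed form by the Jensen/stability chain of that line, composed exactly as in its skeleton);
  `eventually_hasUniqueGroundState_of_bounded` — the eventual form along `L_N = (N/ρ)^{1/3}`, every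
  `ρ > 0`;
* `swapMass_groundState_eq_one_of_bounded` — hence `groundState v (n+1) L` is a.e. a phase times the
  strictly positive Feynman–Kac ground state (`isGroundState_fkGroundState_of_bounded`), a.e. nonzero
  on the box, and ALL of its two-replica mass is accessible: `swapMass = 1`
  (`swapMass_eq_one_of_ae_ne_zero`), in every box, for every bounded `v`;
* `groundStateAccessible_of_unbounded` — the item is reduced to its hard-core branch (H): its own
  conclusion for UNBOUNDED admissible `v` (isolated further as SUPPORT + DENSITY in
  `…GroundStateAccessibleHardCoreGlue.lean`; the conditional bookkeeping with the stubs as hypotheses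
  is `…GroundStateAccessibleReduction.lean`).
-/

noncomputable section

open MeasureTheory Filter Set
open scoped ENNReal NNReal Topology

namespace Summit.AtomisticToContinuum.BoseEinsteinCondensation.Theorems.BECInsertionVariance

open Literature.MathematicalPhysics.QuantumManyBody.BoseGas
open Summit.AtomisticToContinuum.BoseEinsteinCondensation.Theses.BECInsertionVariance
open Summit.AtomisticToContinuum.BoseEinsteinCondensation.Theorems.GroundStateRigidity
  (stub_compactness stub_fkJensen stub_stabilityOfJensen stub_uniqueOfStability)

/-- **Uniqueness of the Dirichlet ground state for bounded pair potentials**: for measurable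
`v ≤ C`, `N ≥ 1`, `L > 0`, `HasUniqueGroundState v N L` (`E₀ < ⊤` from the Feynman–Kac ground
state; Jensen ⇒ stability ⇒ uniqueness given compactness).
[cite: ReedSimonIV1978, §XIII.12 Thms XIII.44 and XIII.47] -/
theorem hasUniqueGroundState_of_bounded {N : ℕ} {v : ℝ → ℝ≥0∞} {L : ℝ} (hN : 1 ≤ N) (hL : 0 < L)
    (hv : Measurable v) {C : ℝ≥0} (hC : ∀ r, v r ≤ C) : HasUniqueGroundState v N L := by
  obtain ⟨Ψ₀, hΨ₀, -, -⟩ := GroundStateFeynmanKac_holds N L v hN hL hv ⟨C, hC⟩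
  have hE : groundStateEnergy v N L ≠ ⊤ := hΨ₀.energy_ne_top
  have hJ := stub_fkJensen N v C L hv hC hL
  exact stub_uniqueOfStability stub_compactness N v L hE (stub_stabilityOfJensen N v C L hN hv hC hL hJ)

/-- **Eventual form along the thermodynamic box sequence** (every density `ρ > 0`, all `N ≥ 1`):
for a BOUNDED repulsive finite-range `v`, `HasUniqueGroundState v N (sideLength ρ N)` eventually — the
bounded half of `eventualUniqueness` of the `GroundStateRigidity` line, unconditional.
[cite: ReedSimonIV1978, §XIII.12 Thm XIII.47] -/
theorem eventually_hasUniqueGroundState_of_bounded {v : ℝ → ℝ≥0∞} (hv : IsRepulsiveFiniteRange v)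
    (hb : ∃ C : ℝ≥0, ∀ r, v r ≤ C) {ρ : ℝ} (hρ : 0 < ρ) :
    ∀ᶠ N : ℕ in atTop, HasUniqueGroundState v N (sideLength ρ N) := by
  obtain ⟨C, hC⟩ := hb
  filter_upwards [eventually_ge_atTop 1] with N hN
  exact hasUniqueGroundState_of_bounded hN (sideLength_pos_of_pos hρ hN) hv.1 hC

/-- **Bounded `v`: all swap mass of the nonnegative ground state is accessible**, in every box:
`swapMass n (groundState v (n+1) L) = 1` for measurable bounded `v` and `L > 0` (`groundState` is a.e.
a phase times the strictly positive Feynman–Kac ground state, hence a.e. nonzero on the box).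
[cite: ReedSimonIV1978, §XIII.12 Thm XIII.47] -/
theorem swapMass_groundState_eq_one_of_bounded {n : ℕ} {L : ℝ} {v : ℝ → ℝ≥0∞} (hL : 0 < L)
    (hv : Measurable v) (hb : ∃ C : ℝ≥0, ∀ r, v r ≤ C) :
    swapMass n (groundState v (n + 1) L) = 1 := by
  have hN : 1 ≤ n + 1 := Nat.succ_pos n
  obtain ⟨C, hC⟩ := hb
  have hU : HasUniqueGroundState v (n + 1) L := hasUniqueGroundState_of_bounded hN hL hv hC
  obtain ⟨hφGS, -, hφpos⟩ := isGroundState_fkGroundState_of_bounded hN hL hv ⟨C, hC⟩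
  have hgs : IsGroundState v L (fun X => (groundState v (n + 1) L X : ℂ)) :=
    hU.isGroundState_groundState
  obtain ⟨c, -, hae⟩ := hU.2 _ _ hgs hφGS
  have hne : ∀ᵐ X : Config (n + 1), X ∈ boxN (n + 1) L → groundState v (n + 1) L X ≠ 0 := by
    filter_upwards [hae] with X hX hXbox h0
    have h1 : (fkGroundState v (n + 1) L X : ℂ) = 0 := by rw [hX, h0]; simp
    exact (hφpos X hXbox).ne' (by exact_mod_cast h1)
  exact swapMass_eq_one_of_ae_ne_zero (measurable_groundState v (n + 1) L)
    (groundState_nonneg v (n + 1) L) (fun X hX => groundState_eq_zero_of_not_mem v hX) hne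
    (lintegral_groundState_sq hU.1)

/-- **Reduction of `GroundStateAccessible` to its hard-core branch.** The item follows from its own
conclusion restricted to UNBOUNDED admissible `v` (hard cores, hard shells, non-integrable cores);
for bounded `v` it holds with `ρ₀ = 1` and swap mass exactly `1`
(`swapMass_groundState_eq_one_of_bounded`). [folklore] -/
theorem groundStateAccessible_of_unbounded
    (hHard : ∀ v : ℝ → ℝ≥0∞, IsRepulsiveFiniteRange v → (¬ ∃ C : ℝ≥0, ∀ r, v r ≤ C) →
      ∃ ρ₀ : ℝ, 0 < ρ₀ ∧ ∀ ρ : ℝ, 0 < ρ → ρ < ρ₀ → ∀ᶠ n : ℕ in atTop,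
        (1 / 2 : ℝ≥0∞) ≤ swapMass n (groundState v (n + 1) (sideLength ρ (n + 1)))) :
    GroundStateAccessible := by
  intro v hv
  by_cases hb : ∃ C : ℝ≥0, ∀ r, v r ≤ C
  · refine ⟨1, one_pos, fun ρ hρ _ => Eventually.of_forall fun n => ?_⟩
    show (1 / 2 : ℝ≥0∞) ≤ swapMass n (groundState v (n + 1) (sideLength ρ (n + 1)))
    rw [swapMass_groundState_eq_one_of_bounded (sideLength_pos_of_pos hρ (Nat.succ_pos n)) hv.1 hb]
    exact ENNReal.half_le_self
  · obtain ⟨ρ₀, hρ₀, hev⟩ := hHard v hv hb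
    refine ⟨ρ₀, hρ₀, fun ρ hρ hρ' => ?_⟩
    filter_upwards [hev ρ hρ hρ'] with n hn
    exact hn

end Summit.AtomisticToContinuum.BoseEinsteinCondensation.Theorems.BECInsertionVariance

end
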